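import Mathlib
import HarnessLib
import Literature.Computability.ImplicitComplexity.ObsessionalCliques
import Literature.Computability.ImplicitComplexity.CliqueDecides

/-!
# Obsessional cliques: topic-level entry point, the lattice of `t`-obsessional cliques, and
# saturation for "obsessional from `t`"

Complement to `Literature.Computability.ImplicitComplexity.ObsessionalCliques` (the untyped
relational space `URel.Point` of Laurent–Tortora de Falco, LICS 2006 = LTdF, §5.1, its `t`-action
`URel.Point.act`, `URel.IsObsessional`, `URel.ObsessionalFrom`, `URel.ObsessionalClique`,
`URel.obsessionalHull`) and to `…CliqueDecides` (the word→boolean interface), for the route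
PneNP/LightLogic (cruxes `AbsoluteObsessionality`, `OracleRefusal`).

* `ObsessionalClique t` — the notion under its topic-level name
  `Literature.Computability.ImplicitComplexity.ObsessionalClique`: the type of `t`-obsessional
  cliques of `D` (LTdF Def. 3 for the `ℕ`-set `Dₜ` of Def. 13), definitionally
  `URel.ObsessionalClique t`; all the API lives in the namespace `URel`.
* `URel.ObsessionalClique.hull t c` — the free `t`-obsessional clique on a set of points (its orbit
  `URel.obsessionalHull t c`, bundled), the Galois insertion `hull t ⊣ (↑)` and the resulting
  `CompleteLattice (ObsessionalClique t)`: suprema are unions and infima intersections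
  (`coe_sup`, `coe_inf`, `coe_sSup`, `coe_sInf`, `coe_top`, `coe_bot`), because `t`-obsessional
  cliques are closed under both (a sub-complete-lattice of `Set Point`).
* `URel.obsessionalFromHull t c` — the SATURATION of a clique for the property "obsessional from
  `t`" (the morphism condition of LTdF's model `SREL` of soft linear logic, Def. 4 / Def. 13 /
  Prop. 8): the least clique containing `c` that is `t'`-obsessional for every `t' ≥ t`.  Unlike the
  `t`-obsessional hull this is NOT a single orbit — the `t'`-actions for different `t'` do not
  commute — so it is defined as an intersection and characterised inductively
  (`URel.ObsessionalFromGen`, `URel.mem_obsessionalFromHull_iff`); it is a closure operator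
  (`URel.obsessionalFromClosure`), antitone in `t`, and contains every `obsessionalHull t' c`,
  `t' ≥ t`.  This is the "Φ-saturation" of crux `OracleRefusal` for Φ = obsessional-from-`t`.
* Interface lemmas: saturating a predicate clique can only ADD outputs (`URel.feed_subset_feed_*`),
  and two nested cliques that both decide a language decide the same one
  (`URel.CliqueDecides.eq_of_subset`) — so a saturation either stops deciding (totality/consistency
  breaks) or decides the same language.
* `URel.obsessionalFrom_one_derelictionClique` / `URel.not_obsessionalFrom_zero_derelictionClique`:
  the dereliction clique `{?[x̄] ⅋ x}` is obsessional from `1` and not from `0` (untyped form of the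
  remark of LTdF §2.2), whence `obsessionalFromHull 1` fixes it and `obsessionalFromHull 0` strictly
  enlarges it (non-vacuity of the saturation).

## References

* O. Laurent, L. Tortora de Falco, *Obsessional cliques: a semantic characterization of bounded
  time complexity*, LICS 2006, 179–188, doi:10.1109/lics.2006.37 — Def. 1–4 and Prop. 1 (§2.2:
  `ℕ`-sets, `NREL`, obsessional cliques, `OREL`, `SREL`), §5.1 Def. 13 (`t`-obsessional,
  obsessional from `t`), §5.2 Prop. 8, §5.3 and §6 (relative vs. absolute completeness).
-/

namespace Literature.Computability.ImplicitComplexity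

namespace URel

/-! ### The complete lattice of `t`-obsessional cliques -/

/-- `D` is inhabited (by the point `1`). [cite: LaurentTortoraDeFalco2006, §5.1] -/
instance Point.instInhabited : Inhabited Point := ⟨Point.one⟩

/-- The default point is `1`. [cite: LaurentTortoraDeFalco2006, §5.1] -/
@[simp] theorem Point.default_eq : (default : Point) = Point.one := rfl

section Hull

variable {t : ℕ} {c d : Set Point}

/-- A `t`-obsessional clique is its own hull. [cite: LaurentTortoraDeFalco2006, Def. 13] -/
theorem IsObsessional.obsessionalHull_eq (hc : IsObsessional t c) : obsessionalHull t c = c :=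
  (obsessionalHull_subset subset_rfl hc).antisymm subset_obsessionalHull

/-- The hull is monotone. [cite: LaurentTortoraDeFalco2006, Def. 13] -/
theorem obsessionalHull_mono (h : c ⊆ d) : obsessionalHull t c ⊆ obsessionalHull t d :=
  obsessionalHull_subset (h.trans subset_obsessionalHull) isObsessional_obsessionalHull

/-- The hull is idempotent. [cite: LaurentTortoraDeFalco2006, Def. 13] -/
theorem obsessionalHull_obsessionalHull (t : ℕ) (c : Set Point) :
    obsessionalHull t (obsessionalHull t c) = obsessionalHull t c :=
  isObsessional_obsessionalHull.obsessionalHull_eq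

end Hull

namespace ObsessionalClique

variable {t : ℕ}

/-- `t`-obsessional cliques are ordered by inclusion of their underlying sets.
[cite: LaurentTortoraDeFalco2006, Def. 3] -/
instance instPartialOrder (t : ℕ) : PartialOrder (ObsessionalClique t) :=
  .ofSetLike (ObsessionalClique t) Point

/-- Bundle a `t`-obsessional set of points as an obsessional clique.
[cite: LaurentTortoraDeFalco2006, Def. 3] -/
def ofSet (c : Set Point) (hc : IsObsessional t c) : ObsessionalClique t := ⟨c, hc⟩

/-- The underlying set of `ofSet c hc` is `c`. [cite: LaurentTortoraDeFalco2006, Def. 3] -/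
@[simp] theorem coe_ofSet (c : Set Point) (hc : IsObsessional t c) : (ofSet c hc : Set Point) = c :=
  rfl

/-- Membership in `ofSet c hc` is membership in `c`. [cite: LaurentTortoraDeFalco2006, Def. 3] -/
@[simp] theorem mem_ofSet {c : Set Point} (hc : IsObsessional t c) {x : Point} :
    x ∈ ofSet c hc ↔ x ∈ c :=
  Iff.rfl

/-- The order is inclusion of the underlying sets. [cite: LaurentTortoraDeFalco2006, Def. 3] -/
theorem le_iff_subset {C D : ObsessionalClique t} : C ≤ D ↔ (C : Set Point) ⊆ D :=
  SetLike.coe_subset_coe.symm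

/-- An obsessional clique is closed under the `t`-action of `ℕ*` (Def. 3: `∀ a ∈ c, ∀ k ∈ ℕ*,
a⁽ᵏ⁾ ∈ c`). [cite: LaurentTortoraDeFalco2006, Def. 3] -/
theorem act_mem (C : ObsessionalClique t) {x : Point} (hx : x ∈ C) {k : ℕ} (hk : 0 < k) :
    x.act t k ∈ C :=
  C.isObsessional hx hk

/-- A set of points underlies a (necessarily unique) `t`-obsessional clique iff it is
`t`-obsessional. [cite: LaurentTortoraDeFalco2006, Def. 3] -/
theorem exists_coe_eq_iff {c : Set Point} :
    (∃ C : ObsessionalClique t, (C : Set Point) = c) ↔ IsObsessional t c :=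
  ⟨fun ⟨C, hC⟩ => hC ▸ C.isObsessional, fun hc => ⟨ofSet c hc, rfl⟩⟩

/-- The FREE `t`-obsessional clique on a set of points `c`: its orbit `obsessionalHull t c` under
the `t`-action (already closed, by the monoid law of Def. 1), bundled.
[cite: LaurentTortoraDeFalco2006, Def. 13] -/
def hull (t : ℕ) (c : Set Point) : ObsessionalClique t :=
  ofSet (obsessionalHull t c) isObsessional_obsessionalHull

/-- The underlying set of the free obsessional clique. [cite: LaurentTortoraDeFalco2006, Def. 13] -/
@[simp] theorem coe_hull (t : ℕ) (c : Set Point) : (hull t c : Set Point) = obsessionalHull t c :=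
  rfl

/-- Membership in the free obsessional clique: `y ∈ hull t c ↔ y = (x)ₜ⁽ᵏ⁾` for some `x ∈ c`,
`k ≥ 1`. [cite: LaurentTortoraDeFalco2006, Def. 13] -/
theorem mem_hull_iff {c : Set Point} {y : Point} :
    y ∈ hull t c ↔ ∃ x ∈ c, ∃ k : ℕ, 0 < k ∧ x.act t k = y :=
  Iff.rfl

/-- `hull t` is left adjoint to the forgetful map: `hull t c ≤ D ↔ c ⊆ D`.
[cite: LaurentTortoraDeFalco2006, Def. 13] -/
theorem gc_hull (t : ℕ) : GaloisConnection (hull t) ((↑) : ObsessionalClique t → Set Point) := by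
  intro c D
  constructor
  · intro h x hx
    exact SetLike.le_def.1 h (subset_obsessionalHull hx)
  · intro h
    exact SetLike.le_def.2 fun x hx => obsessionalHull_subset h D.isObsessional hx

/-- The Galois insertion `hull t ⊣ (↑)` (an obsessional clique is its own hull).
[cite: LaurentTortoraDeFalco2006, Def. 13] -/
def giHull (t : ℕ) : GaloisInsertion (hull t) ((↑) : ObsessionalClique t → Set Point) :=
  (gc_hull t).toGaloisInsertion fun _ => SetLike.le_def.2 fun _ hx => subset_obsessionalHull hx

/-- The hull of an obsessional clique is itself. [cite: LaurentTortoraDeFalco2006, Def. 13] -/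
@[simp] theorem hull_coe (C : ObsessionalClique t) : hull t (C : Set Point) = C :=
  (giHull t).l_u_eq C

/-- `t`-obsessional cliques form a complete lattice (lifted along `giHull`); since they are closed
under arbitrary unions AND intersections, all suprema/infima are computed in `Set Point`
(`coe_sup`, `coe_inf`, `coe_sSup`, `coe_sInf`). [cite: LaurentTortoraDeFalco2006, Def. 3] -/
instance instCompleteLattice (t : ℕ) : CompleteLattice (ObsessionalClique t) :=
  (giHull t).liftCompleteLattice

/-- Binary suprema are unions. [cite: LaurentTortoraDeFalco2006, Def. 3] -/
@[simp] theorem coe_sup (C D : ObsessionalClique t) :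
    ((C ⊔ D : ObsessionalClique t) : Set Point) = (C : Set Point) ∪ D := by
  rw [← (giHull t).l_sup_u C D, coe_hull]
  exact (C.isObsessional.union D.isObsessional).obsessionalHull_eq

/-- Binary infima are intersections. [cite: LaurentTortoraDeFalco2006, Def. 3] -/
@[simp] theorem coe_inf (C D : ObsessionalClique t) :
    ((C ⊓ D : ObsessionalClique t) : Set Point) = (C : Set Point) ∩ D := by
  rw [← (giHull t).l_inf_u C D, coe_hull]
  exact (C.isObsessional.inter D.isObsessional).obsessionalHull_eq

/-- Suprema are unions. [cite: LaurentTortoraDeFalco2006, Def. 3] -/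
theorem coe_sSup (S : Set (ObsessionalClique t)) :
    ((sSup S : ObsessionalClique t) : Set Point) = ⋃ C ∈ S, (C : Set Point) := by
  rw [← (giHull t).l_sSup_u_image S, coe_hull, Set.sSup_eq_sUnion, Set.sUnion_image]
  refine IsObsessional.obsessionalHull_eq ?_
  rw [← Set.sUnion_image]
  exact isObsessional_sUnion (Set.forall_mem_image.2 fun C _ => C.isObsessional)

/-- Infima are intersections. [cite: LaurentTortoraDeFalco2006, Def. 3] -/
theorem coe_sInf (S : Set (ObsessionalClique t)) :
    ((sInf S : ObsessionalClique t) : Set Point) = ⋂ C ∈ S, (C : Set Point) := by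
  rw [← (giHull t).l_sInf_u_image S, coe_hull, Set.sInf_eq_sInter, Set.sInter_image]
  refine IsObsessional.obsessionalHull_eq ?_
  rw [← Set.sInter_image]
  exact isObsessional_sInter (Set.forall_mem_image.2 fun C _ => C.isObsessional)

/-- The top obsessional clique is all of `D`. [cite: LaurentTortoraDeFalco2006, Def. 3] -/
@[simp] theorem coe_top : ((⊤ : ObsessionalClique t) : Set Point) = Set.univ := by
  rw [← (giHull t).l_top, coe_hull, Set.top_eq_univ]
  exact isObsessional_univ.obsessionalHull_eq

/-- The bottom obsessional clique is empty. [cite: LaurentTortoraDeFalco2006, Def. 3] -/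
@[simp] theorem coe_bot : ((⊥ : ObsessionalClique t) : Set Point) = ∅ := by
  rw [← (gc_hull t).l_bot, coe_hull, Set.bot_eq_empty]
  exact isObsessional_empty.obsessionalHull_eq

/-- Membership in a binary supremum. [cite: LaurentTortoraDeFalco2006, Def. 3] -/
@[simp] theorem mem_sup {C D : ObsessionalClique t} {x : Point} : x ∈ C ⊔ D ↔ x ∈ C ∨ x ∈ D := by
  rw [← SetLike.mem_coe, coe_sup, Set.mem_union, SetLike.mem_coe, SetLike.mem_coe]

/-- Membership in a binary infimum. [cite: LaurentTortoraDeFalco2006, Def. 3] -/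
@[simp] theorem mem_inf {C D : ObsessionalClique t} {x : Point} : x ∈ C ⊓ D ↔ x ∈ C ∧ x ∈ D := by
  rw [← SetLike.mem_coe, coe_inf, Set.mem_inter_iff, SetLike.mem_coe, SetLike.mem_coe]

/-- No point lies in `⊥`. [cite: LaurentTortoraDeFalco2006, Def. 3] -/
@[simp] theorem not_mem_bot (x : Point) : x ∉ (⊥ : ObsessionalClique t) := by
  rw [← SetLike.mem_coe, coe_bot]
  exact Set.notMem_empty x

/-- Every point lies in `⊤`. [cite: LaurentTortoraDeFalco2006, Def. 3] -/
@[simp] theorem mem_top (x : Point) : x ∈ (⊤ : ObsessionalClique t) := by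
  rw [← SetLike.mem_coe, coe_top]
  exact Set.mem_univ x

end ObsessionalClique

/-! ### "Obsessional from `t`": closure properties -/

section From

variable {t : ℕ} {c d : Set Point}

/-- The empty clique is obsessional from every `t`. [cite: LaurentTortoraDeFalco2006, Def. 13] -/
theorem obsessionalFrom_empty : ObsessionalFrom t (∅ : Set Point) := fun _ _ => isObsessional_empty

/-- The full clique is obsessional from every `t`. [cite: LaurentTortoraDeFalco2006, Def. 13] -/
theorem obsessionalFrom_univ : ObsessionalFrom t (Set.univ : Set Point) :=
  fun _ _ => isObsessional_univ

/-- Cliques obsessional from `t` are closed under intersection. [cite: LaurentTortoraDeFalco2006, Def. 13] -/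
theorem ObsessionalFrom.inter (hc : ObsessionalFrom t c) (hd : ObsessionalFrom t d) :
    ObsessionalFrom t (c ∩ d) := fun _ ht => (hc ht).inter (hd ht)

/-- Cliques obsessional from `t` are closed under union. [cite: LaurentTortoraDeFalco2006, Def. 13] -/
theorem ObsessionalFrom.union (hc : ObsessionalFrom t c) (hd : ObsessionalFrom t d) :
    ObsessionalFrom t (c ∪ d) := fun _ ht => (hc ht).union (hd ht)

/-- Cliques obsessional from `t` are closed under arbitrary intersections.
[cite: LaurentTortoraDeFalco2006, Def. 13] -/
theorem obsessionalFrom_sInter {S : Set (Set Point)} (h : ∀ c ∈ S, ObsessionalFrom t c) :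
    ObsessionalFrom t (⋂₀ S) := fun _ ht => isObsessional_sInter fun c hc => h c hc ht

/-- Cliques obsessional from `t` are closed under arbitrary unions.
[cite: LaurentTortoraDeFalco2006, Def. 13] -/
theorem obsessionalFrom_sUnion {S : Set (Set Point)} (h : ∀ c ∈ S, ObsessionalFrom t c) :
    ObsessionalFrom t (⋃₀ S) := fun _ ht => isObsessional_sUnion fun c hc => h c hc ht

/-- A clique of exponential-free (`MLL`) points is obsessional from every `t`.
[cite: LaurentTortoraDeFalco2006, §5.3] -/
theorem obsessionalFrom_of_isExpFree
    (h : ∀ p ∈ c, ∃ x : PrePoint, Point.mk x = p ∧ x.IsExpFree) : ObsessionalFrom t c :=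
  fun _ _ => isObsessional_of_isExpFree h

/-- The dereliction clique `{?[x̄] ⅋ x | x ∈ D}` is obsessional from `1` (singletons are below every
positive threshold). [cite: LaurentTortoraDeFalco2006, §2.2] -/
theorem obsessionalFrom_one_derelictionClique : ObsessionalFrom 1 derelictionClique := by
  intro t' ht
  obtain ⟨s, rfl⟩ := Nat.exists_eq_add_of_le' ht
  exact isObsessional_succ_derelictionClique s

/-- … but not from `0` ("dereliction is not obsessional in `!₀A × A`").
[cite: LaurentTortoraDeFalco2006, §2.2] -/
theorem not_obsessionalFrom_zero_derelictionClique : ¬ ObsessionalFrom 0 derelictionClique :=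
  fun h => not_isObsessional_zero_derelictionClique (h le_rfl)

end From

/-! ### Saturation for "obsessional from `t`" -/

section Saturation

variable {t t' : ℕ} {c d : Set Point}

/-- The **saturation** of a clique for "obsessional from `t`": the least clique containing `c` that
is `t'`-obsessional for every `t' ≥ t` (the intersection of all such cliques; see
`mem_obsessionalFromHull_iff` for the inductive description).  "Obsessional from some `t`" is the
morphism condition of the model `SREL` of soft linear logic (Def. 4, Prop. 8); the operation itself
is not printed in LTdF. [cite: LaurentTortoraDeFalco2006, Def. 13] -/
def obsessionalFromHull (t : ℕ) (c : Set Point) : Set Point :=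
  ⋂₀ {d | c ⊆ d ∧ ObsessionalFrom t d}

/-- A clique is contained in its saturation. [cite: LaurentTortoraDeFalco2006, Def. 13] -/
theorem subset_obsessionalFromHull : c ⊆ obsessionalFromHull t c :=
  fun _ hx => Set.mem_sInter.2 fun _ hd => hd.1 hx

/-- The saturation is obsessional from `t`. [cite: LaurentTortoraDeFalco2006, Def. 13] -/
theorem obsessionalFrom_obsessionalFromHull : ObsessionalFrom t (obsessionalFromHull t c) :=
  obsessionalFrom_sInter fun _ hd => hd.2

/-- The saturation is `t'`-obsessional for every `t' ≥ t`. [cite: LaurentTortoraDeFalco2006, Def. 13] -/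
theorem isObsessional_obsessionalFromHull (h : t ≤ t') : IsObsessional t' (obsessionalFromHull t c) :=
  obsessionalFrom_obsessionalFromHull h

/-- The saturation is the LEAST clique containing `c` that is obsessional from `t`.
[cite: LaurentTortoraDeFalco2006, Def. 13] -/
theorem obsessionalFromHull_subset (hcd : c ⊆ d) (hd : ObsessionalFrom t d) :
    obsessionalFromHull t c ⊆ d :=
  Set.sInter_subset_of_mem ⟨hcd, hd⟩

/-- `IsLeast` form of the universal property. [cite: LaurentTortoraDeFalco2006, Def. 13] -/
theorem isLeast_obsessionalFromHull (t : ℕ) (c : Set Point) :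
    IsLeast {d | c ⊆ d ∧ ObsessionalFrom t d} (obsessionalFromHull t c) :=
  ⟨⟨subset_obsessionalFromHull, obsessionalFrom_obsessionalFromHull⟩,
    fun _ hd => obsessionalFromHull_subset hd.1 hd.2⟩

/-- A clique is obsessional from `t` iff it contains its saturation.
[cite: LaurentTortoraDeFalco2006, Def. 13] -/
theorem obsessionalFrom_iff_obsessionalFromHull_subset :
    ObsessionalFrom t c ↔ obsessionalFromHull t c ⊆ c :=
  ⟨fun h => obsessionalFromHull_subset subset_rfl h, fun h => by
    rw [← h.antisymm subset_obsessionalFromHull]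
    exact obsessionalFrom_obsessionalFromHull⟩

/-- A clique is obsessional from `t` iff it equals its saturation.
[cite: LaurentTortoraDeFalco2006, Def. 13] -/
theorem obsessionalFrom_iff_obsessionalFromHull_eq : ObsessionalFrom t c ↔ obsessionalFromHull t c = c :=
  obsessionalFrom_iff_obsessionalFromHull_subset.trans
    ⟨fun h => h.antisymm subset_obsessionalFromHull, fun h => h.le⟩

/-- A clique obsessional from `t` is its own saturation. [cite: LaurentTortoraDeFalco2006, Def. 13] -/
theorem ObsessionalFrom.obsessionalFromHull_eq (hc : ObsessionalFrom t c) : obsessionalFromHull t c = c :=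
  obsessionalFrom_iff_obsessionalFromHull_eq.1 hc

/-- The saturation is monotone in the clique. [cite: LaurentTortoraDeFalco2006, Def. 13] -/
theorem obsessionalFromHull_mono (h : c ⊆ d) : obsessionalFromHull t c ⊆ obsessionalFromHull t d :=
  obsessionalFromHull_subset (h.trans subset_obsessionalFromHull) obsessionalFrom_obsessionalFromHull

/-- The saturation is ANTITONE in the threshold: raising `t` asks for less.
[cite: LaurentTortoraDeFalco2006, Def. 13] -/
theorem obsessionalFromHull_anti (h : t ≤ t') : obsessionalFromHull t' c ⊆ obsessionalFromHull t c :=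
  obsessionalFromHull_subset subset_obsessionalFromHull (obsessionalFrom_obsessionalFromHull.mono h)

/-- The saturation is idempotent. [cite: LaurentTortoraDeFalco2006, Def. 13] -/
theorem obsessionalFromHull_obsessionalFromHull (t : ℕ) (c : Set Point) :
    obsessionalFromHull t (obsessionalFromHull t c) = obsessionalFromHull t c :=
  obsessionalFrom_obsessionalFromHull.obsessionalFromHull_eq

/-- The saturation contains every `t'`-orbit, `t' ≥ t` (in particular the `t`-obsessional hull).
[cite: LaurentTortoraDeFalco2006, Def. 13] -/
theorem obsessionalHull_subset_obsessionalFromHull (h : t ≤ t') :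
    obsessionalHull t' c ⊆ obsessionalFromHull t c :=
  obsessionalHull_subset subset_obsessionalFromHull (obsessionalFrom_obsessionalFromHull h)

/-- The empty clique is saturated. [cite: LaurentTortoraDeFalco2006, Def. 13] -/
@[simp] theorem obsessionalFromHull_empty (t : ℕ) : obsessionalFromHull t (∅ : Set Point) = ∅ :=
  obsessionalFrom_empty.obsessionalFromHull_eq

/-- The saturation as a closure operator on `Set Point`, whose closed sets are exactly the cliques
obsessional from `t`. [cite: LaurentTortoraDeFalco2006, Def. 13] -/
def obsessionalFromClosure (t : ℕ) : ClosureOperator (Set Point) :=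
  ClosureOperator.ofPred (obsessionalFromHull t) (ObsessionalFrom t)
    (fun _ => subset_obsessionalFromHull) (fun _ => obsessionalFrom_obsessionalFromHull)
    fun _ _ hcd hd => obsessionalFromHull_subset hcd hd

/-- The closure operator is the saturation. [cite: LaurentTortoraDeFalco2006, Def. 13] -/
@[simp] theorem obsessionalFromClosure_apply (t : ℕ) (c : Set Point) :
    obsessionalFromClosure t c = obsessionalFromHull t c := rfl

/-- Its closed sets are the cliques obsessional from `t`. [cite: LaurentTortoraDeFalco2006, Def. 13] -/
theorem obsessionalFromClosure_isClosed_iff (t : ℕ) (c : Set Point) :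
    (obsessionalFromClosure t).IsClosed c ↔ ObsessionalFrom t c := Iff.rfl

/-- Inductive presentation of the saturation: generated from the points of `c` by all the actions
`x ↦ (x)_{t'}⁽ᵏ⁾` with `t' ≥ t` and `k ≥ 1` (finite words in these actions — they do not commute, so
this is more than the union of the orbits). [cite: LaurentTortoraDeFalco2006, Def. 13] -/
inductive ObsessionalFromGen (t : ℕ) (c : Set Point) : Point → Prop
  /-- points of `c` are generated -/
  | mem {x : Point} (hx : x ∈ c) : ObsessionalFromGen t c x
  /-- generated points are closed under every `t'`-action, `t' ≥ t`, with positive factor -/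
  | act {x : Point} {t' k : ℕ} (ht : t ≤ t') (hk : 0 < k) (hx : ObsessionalFromGen t c x) :
      ObsessionalFromGen t c (x.act t' k)

/-- The saturation is exactly the set of generated points. [cite: LaurentTortoraDeFalco2006, Def. 13] -/
theorem mem_obsessionalFromHull_iff {x : Point} :
    x ∈ obsessionalFromHull t c ↔ ObsessionalFromGen t c x := by
  constructor
  · intro hx
    have h : obsessionalFromHull t c ⊆ {y | ObsessionalFromGen t c y} :=
      obsessionalFromHull_subset (fun y hy => ObsessionalFromGen.mem hy)
        fun t' ht y hy k hk => ObsessionalFromGen.act ht hk hy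
    exact h hx
  · intro hx
    induction hx with
    | mem hy => exact subset_obsessionalFromHull hy
    | act ht hk _ ih => exact obsessionalFrom_obsessionalFromHull ht ih hk

/-- The dereliction clique is saturated for `t = 1`. [cite: LaurentTortoraDeFalco2006, §2.2] -/
theorem obsessionalFromHull_one_derelictionClique :
    obsessionalFromHull 1 derelictionClique = derelictionClique :=
  obsessionalFrom_one_derelictionClique.obsessionalFromHull_eq

/-- … and strictly enlarged by the saturation for `t = 0` (non-vacuity of the saturation).
[cite: LaurentTortoraDeFalco2006, §2.2] -/
theorem derelictionClique_ssubset_obsessionalFromHull_zero :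
    derelictionClique ⊂ obsessionalFromHull 0 derelictionClique :=
  subset_obsessionalFromHull.ssubset_of_ne fun h =>
    not_obsessionalFrom_zero_derelictionClique (obsessionalFrom_iff_obsessionalFromHull_eq.2 h.symm)

end Saturation

/-! ### Saturation at the word→boolean interface -/

section Interface

variable {t k : ℕ} {c d : Set Point}

/-- Enlarging a predicate clique can only ADD outputs on every argument; in particular for its
`t`-obsessional hull … [cite: LaurentTortoraDeFalco2006, Def. 12] -/
theorem feed_subset_feed_obsessionalHull (A : Set Point) :
    feed k c A ⊆ feed k (obsessionalHull t c) A :=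
  feed_mono subset_obsessionalHull subset_rfl

/-- … and for its saturation. [cite: LaurentTortoraDeFalco2006, Def. 12] -/
theorem feed_subset_feed_obsessionalFromHull (A : Set Point) :
    feed k c A ⊆ feed k (obsessionalFromHull t c) A :=
  feed_mono subset_obsessionalFromHull subset_rfl

/-- The twist point `(1 ⅋ ⊥) ⅋ (1 ⊗ ⊥)` of `⟦ff⟧` is not in `⟦tt⟧`. [folklore] -/
theorem ffPoint_one_bot_not_mem : Point.ffPoint Point.one Point.bot ∉ boolClique true := by
  rintro ⟨a, b, h⟩
  simp only [Point.ttPoint, Point.ffPoint, Point.par_inj, Point.tensor_inj, Point.dual_one,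
    Point.dual_bot] at h
  obtain ⟨⟨rfl, rfl⟩, h2, -⟩ := h
  exact Point.one_ne_bot (h2.trans Point.dual_one)

/-- Neither of `⟦tt⟧`, `⟦ff⟧` contains the other. [folklore] -/
theorem not_boolClique_subset {b b' : Bool} (h : b ≠ b') : ¬ boolClique b ⊆ boolClique b' := by
  cases b <;> cases b'
  · exact (h rfl).elim
  · exact fun hs => ffPoint_one_bot_not_mem (hs ⟨_, _, rfl⟩)
  · exact fun hs => ttPoint_one_bot_not_mem (hs ⟨_, _, rfl⟩)
  · exact (h rfl).elim

/-- Inclusion between `⟦b⟧` and `⟦b'⟧` forces `b = b'`. [folklore] -/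
theorem boolClique_subset_iff {b b' : Bool} : boolClique b ⊆ boolClique b' ↔ b = b' :=
  ⟨fun hs => by_contra fun h => not_boolClique_subset h hs, fun h => h ▸ subset_rfl⟩

/-- Two NESTED cliques that both decide a language decide the same one: enlarging a deciding clique
(e.g. saturating it) either destroys totality/consistency at the interface or changes nothing
observable. [folklore] -/
theorem CliqueDecides.eq_of_subset {L L' : Language Bool} (hcd : c ⊆ d) (hc : CliqueDecides k c L)
    (hd : CliqueDecides k d L') : L = L' := by
  ext w
  have hw : feed k c (wordClique w) ⊆ feed k d (wordClique w) := feed_mono hcd subset_rfl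
  constructor
  · intro h
    by_contra h'
    rw [(hc w).1 h, (hd w).2 h'] at hw
    exact not_boolClique_subset (by decide) hw
  · intro h'
    by_contra h
    rw [(hc w).2 h, (hd w).1 h'] at hw
    exact not_boolClique_subset (by decide) hw

/-- In particular: if the saturation of a deciding clique still decides some language, it is the
same language. [folklore] -/
theorem CliqueDecides.eq_of_obsessionalFromHull {L L' : Language Bool} (hc : CliqueDecides k c L)
    (hd : CliqueDecides k (obsessionalFromHull t c) L') : L = L' :=
  hc.eq_of_subset subset_obsessionalFromHull hd

end Interface

end URel

/-! ### Topic-level name of the notion -/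

/-- **Obsessional cliques** (topic-level name of the notion).  For an `ℕ`-set `A` — a set with an
action `(k, a) ↦ a⁽ᵏ⁾` of the monoid `(ℕ*, ·, 1)` — "a clique `c` is obsessional if
`∀ a ∈ c, ∀ k ∈ ℕ*, a⁽ᵏ⁾ ∈ c`" (Def. 3); here for the `ℕ`-set `Dₜ` = the untyped space `D` of
points with its `t`-action (Def. 13: "`c` is `t`-obsessional if `∀ x ∈ c, ∀ k ∈ ℕ*, (x)ₜ⁽ᵏ⁾ ∈ c`").
`ObsessionalClique t` is the type of `t`-obsessional cliques of `D`; it is DEFINITIONALLY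
`URel.ObsessionalClique t` (file `ObsessionalCliques`), where all the API lives: the predicate forms
`URel.IsObsessional t c` / `URel.ObsessionalFrom t c` ("obsessional from `t`" = `t'`-obsessional for
all `t' ≥ t`, the morphisms of `SREL`), the free clique `URel.ObsessionalClique.hull`, the complete
lattice structure, and the saturation `URel.obsessionalFromHull`.
[cite: LaurentTortoraDeFalco2006, Def. 3 and Def. 13] -/
abbrev ObsessionalClique (t : ℕ) : Type := URel.ObsessionalClique t

namespace ObsessionalClique

/-- Unfolding: the underlying set of an obsessional clique is `t`-obsessional, i.e. closed under
the `t`-action of `ℕ*`. [cite: LaurentTortoraDeFalco2006, Def. 3] -/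
theorem isObsessional_coe {t : ℕ} (C : ObsessionalClique t) :
    URel.IsObsessional t (C : Set URel.Point) :=
  C.isObsessional

/-- Unfolding: the data of an obsessional clique is a `t`-obsessional set of points and nothing
else. [cite: LaurentTortoraDeFalco2006, Def. 3] -/
theorem exists_coe_eq_iff {t : ℕ} {c : Set URel.Point} :
    (∃ C : ObsessionalClique t, (C : Set URel.Point) = c) ↔ URel.IsObsessional t c :=
  URel.ObsessionalClique.exists_coe_eq_iff

end ObsessionalClique

end Literature.Computability.ImplicitComplexity
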